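import Summits.ResolutionOfSingularities.ResolutionOfSingularities.Theorems.FrobeniusLadderFInjectiveMacaulayficationGermOfGlobalBlowup
import Summits.ResolutionOfSingularities.ResolutionOfSingularities.Theorems.FrobeniusLadderFInjectiveMacaulayficationFermatCubicConeChar2
import Summits.ResolutionOfSingularities.ResolutionOfSingularities.Theorems.FrobeniusLadderFInjectiveMacaulayficationFedderAtMaximalIdeal
import Summits.ResolutionOfSingularities.ResolutionOfSingularities.Theorems.FrobeniusLadderFInjectiveMacaulayficationFedderCriterion
import Summits.ResolutionOfSingularities.ResolutionOfSingularities.Theorems.FrobeniusLadderFInjectiveMacaulayficationFedderOrigin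
import Summits.ResolutionOfSingularities.ResolutionOfSingularities.Theorems.FrobeniusLadderFInjectiveMacaulayficationHypersurfaceLocalDim
import Summits.ResolutionOfSingularities.ResolutionOfSingularities.Theorems.FrobeniusLadderFInjectiveMacaulayficationQuotientOriginMaximal
import Literature.AlgebraicGeometry.Resolution.RegularLocalRingsJacobian
import Mathlib.AlgebraicGeometry.Morphisms.FiniteType
import Mathlib.AlgebraicGeometry.Morphisms.Separated
import HarnessLib

/-!
# GERM INSTANCES OF THE F-HALF IN EVERY DIMENSION `d ≥ 4`: the vertex of the Fermat cubic cone `Σ xₗ³ = 0 ⊂ 𝔸ⁿ` in characteristic 2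
# (crux `FInjectiveMacaulayfication` stmt-ResolutionOfSingularities-15315, chain w45a; res-L1-w45a-plan-1 GO 02:37:11Z on res-L1-w45a-stub-1 g9's
# OFFER (B) «GERM INSTANCES IN EXACT CURRENCY», FILE 2; res-L1-w45a-tri-2 #348 (c) «TRIVIAL STRATUM: FULL via a REGULAR model»; seat res-L1-w45a-stub-1 g9)

[OURS · L1 W4.5a] Support file (`--supports stmt-ResolutionOfSingularities-15315 --as helper`); replaces the role of NO printed item; NOT a
statement of the manuscript; def-free, unconditional; a CERTIFICATE, not in the cone of door v36.2's `_proof`. AI-written (AI review is weaker than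
expert review).

## What is here
For every field `k` of characteristic `2`, every `n ≥ 3`, `f = Σ_{l<n} xₗ³`, `X = Spec k[x₀,…,x_{n−1}]/(f)` (the affine cone over the SMOOTH Fermat
cubic `V₊(f) ⊂ ℙⁿ⁻¹`, `∂f/∂xₗ = xₗ²` in characteristic 2) and its VERTEX `v` (the point with prime `(x̄₀, …, x̄_{n−1})`):

* `fInjectivizationGermAt_vertex` — **`GermForm.FInjectivizationGermAt 2 v`**: the blow-up of the closed point of `Spec 𝒪_{X,v}` is FULL at every
  point (certificate: the ONE point blow-up of `X`, res-L1-w45a-lead-1's `FermatCubicConeChar2` certificates re-fed to the explicit-model engine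
  `GermOfGlobalBlowup.fInjectivizationGermAt_origin_of_hypersurfacePointBlowup`);
* the FIVE HYPOTHESES of the germ form `GermForm.LocalFInjectivizationGerm 2 (n − 1)` AT `(X, v)`: `isClosed_vertex` (closed point),
  `vertex_not_mem_regularLocus` (`f ∈ 𝔪²`: Jacobian criterion, singular direction), `ringKrullDim_stalk_vertex` (`dim 𝒪_{X,v} = n − 1`),
  `regular_off_closedPoint_vertex` (ISOLATED: `X` is regular off `v`, some `∂f/∂xⱼ = xⱼ² ∉ P`), `cmCl_Spec_stalk_vertex` (hypersurface ⇒ Cohen–Macaulay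
  at every point, `cmCl_localization` via `Fedder.sop_isWeaklyRegular_quotient`); and the four scheme-level side conditions of the germ form's `∀` (`structureMorphism_isSeparated`, `…_locallyOfFiniteType`,
  `…_quasiCompact`, `isIntegral_cone`);
* ★ `fermatCubicCone_vertex_germ_instance` — the conjunction: **for every `n ≥ 3` the pair `(X, v)` is a POSITIVE INSTANCE, hypotheses AND conclusion,
  of the germ form `LocalFInjectivizationGerm 2 (n − 1)`**, i.e. (by `GermForm.localFInjectivizationFibreAdmGe4_at_top_iff_germ`, res-L1-w45a-tri-2 #337)
  of the registered F-half `LocalFullificationFibreAdmGe4Split.LocalFInjectivizationFibreAdmGe4` at the input `I = ⊤`, in exact currency, ONE PER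
  DIMENSION `d = n − 1` (the F-half's levels are `d ≥ 4`, i.e. `n ≥ 5`).

## Census label (res-L1-w45a-tri-2 #348 (c), binding)
**TRIVIAL STRATUM — «FULL via a REGULAR model»**: the projective Fermat cubic is smooth in characteristic 2, so the one-point blow-up of the cone is
REGULAR (the chart hypersurfaces `1 + Σ_{l≠i} xₗ³` are smooth) and FULL because regular. These instances certify that the F-half's germ form is
CONSISTENT and populated in every dimension; they carry NO content beyond resolution. The informative stratum «FULL model still singular» (res-L1-w45a-idea-1's
DP4 rows, K⁽⁴⁾/T⁽⁴⁾-type specimens) is fed through the same interface (`GermOfGlobalBlowup.hypersurfacePointBlowup_fullCl` accepts Fedder-type chart data).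

[folklore mathematics, OURS as a certificate; cite: Fedder1983, Thm. 1.12; Hartshorne1977, I Thm. 5.1 (Jacobian criterion); Matsumura1987, Thm. 17.4;
GortzWedhorn2020, Prop. 13.91 (2)]
-/

-- single-problem summit: the doubled namespace component is forced
set_option linter.dupNamespace false

noncomputable section

open AlgebraicGeometry CategoryTheory Literature.AlgebraicGeometry.Resolution TopologicalSpace IsLocalRing MvPolynomial

namespace Summit.ResolutionOfSingularities.ResolutionOfSingularities.Theorems.FInjectiveMacaulayfication.FermatCubicConeGerm

open Summit.ResolutionOfSingularities.ResolutionOfSingularities.Theorems.FInjectiveMacaulayfication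
open SliceableCentre GermForm GermOfGlobalBlowup FermatCubicConeChar2 WildPinchClosedCentre

/-! ## §1 The certificates of the one-point blow-up (res-L1-w45a-lead-1's `FermatCubicConeChar2`, re-cut as lemmas) -/

/-- `f(eⱼ) = 1`, so `xᵢ ∤ f`. [folklore] -/
theorem f_not_mem_span_X (k : Type) [Field k] (m : ℕ) (f : MvPolynomial (Fin (m + 3)) k)
    (hf : f = ∑ l : Fin (m + 3), X l ^ 3) (i : Fin (m + 3)) :
    f ∉ Ideal.span {(X i : MvPolynomial (Fin (m + 3)) k)} := by
  rw [Ideal.mem_span_singleton]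
  have hj : ∃ j : Fin (m + 3), j ≠ i := by
    by_cases hi : i = 0
    · exact ⟨1, by rw [hi]; exact (ne_of_lt Fin.zero_lt_one).symm⟩
    · exact ⟨0, fun h => hi h.symm⟩
  obtain ⟨j, hji⟩ := hj
  exact not_X_dvd_of_eval (Pi.single j 1) i (Pi.single_eq_of_ne (Ne.symm hji) _) f
    (by rw [eval_single k f hf j]; exact one_ne_zero)

/-- `gᵢ(0) = 1`, so `xᵢ ∤ gᵢ = 1 + Σ_{l ≠ i} xₗ³`. [folklore] -/
theorem g_not_mem_span_X (k : Type) [Field k] (m : ℕ) (i : Fin (m + 3)) :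
    (1 + ∑ l ∈ Finset.univ.erase i, (X l : MvPolynomial (Fin (m + 3)) k) ^ 3) ∉
      Ideal.span {(X i : MvPolynomial (Fin (m + 3)) k)} := by
  rw [Ideal.mem_span_singleton]
  refine not_X_dvd_of_eval (fun _ => 0) i rfl _ ?_
  simp [zero_pow three_ne_zero]

/-- **Off the vertex `X` is regular**: at a prime `P ⊉ (x̄₀, …, x̄_{n−1})` some `xⱼ ∉ P`, and `∂f/∂xⱼ = xⱼ²` (characteristic 2), so the Jacobian
criterion applies. [cite: Hartshorne1977, I Thm. 5.1] -/
theorem regular_off_vertex (k : Type) [Field k] [CharP k 2] (m : ℕ) (f : MvPolynomial (Fin (m + 3)) k)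
    (hf : f = ∑ l : Fin (m + 3), X l ^ 3)
    (P : Ideal (MvPolynomial (Fin (m + 3)) k ⧸ Ideal.span {f})) [P.IsPrime]
    (hP : ¬ Ideal.span (Set.range fun j : Fin (m + 3) => Ideal.Quotient.mk (Ideal.span {f}) (X j)) ≤ P) :
    IsRegularLocalRing (Localization.AtPrime P) := by
  have h23 := two_three k (n := m + 3)
  have hdf : ∀ j : Fin (m + 3), pderiv j f = X j ^ 2 := fun j => by rw [pderiv_f k f hf j, h23.2, one_mul]
  have hP' : (P.comap (Ideal.Quotient.mk (Ideal.span {f}))).IsPrime := Ideal.comap_isPrime _ _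
  obtain ⟨_, ⟨j, rfl⟩, hj⟩ := Set.not_subset.mp (fun h => hP (Ideal.span_le.mpr h))
  have hj' : (X j : MvPolynomial (Fin (m + 3)) k) ∉ P.comap (Ideal.Quotient.mk (Ideal.span {f})) := hj
  exact HypersurfaceRegular.stub_hypersurfaceRegularOfPderiv k (m + 3) f j P
    (by rw [hdf j]; exact fun h => hj' (hP'.mem_of_pow_mem 2 h))

/-- **The chart hypersurfaces `gᵢ = 1 + Σ_{l≠i} xₗ³` are REGULAR, hence satisfy the CM + Frobenius-closed clause at every maximal ideal**: some
`xⱼ ∉ Q` with `j ≠ i` (else `Σ_{l≠i} xₗ³ ∈ Q` and `1 = gᵢ − Σ ∈ Q`), and `∂gᵢ/∂xⱼ = xⱼ²`. (Trivial stratum: FULL because regular.)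
[cite: Hartshorne1977, I Thm. 5.1; Matsumura1987, Thm. 17.4] -/
theorem chart_clause (k : Type) [Field k] [CharP k 2] (m : ℕ) (i : Fin (m + 3))
    (Q : Ideal (MvPolynomial (Fin (m + 3)) k ⧸ Ideal.span
      {(1 + ∑ l ∈ Finset.univ.erase i, (X l : MvPolynomial (Fin (m + 3)) k) ^ 3)})) [Q.IsMaximal] :
    ∀ d : ℕ, ringKrullDim (Localization.AtPrime Q) = d → ∀ s : Fin d → Localization.AtPrime Q,
      (Ideal.span (Set.range s)).radical.IsMaximal →
        RingTheory.Sequence.IsWeaklyRegular (Localization.AtPrime Q) (List.ofFn s) ∧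
        ∀ y : Localization.AtPrime Q, (∃ e : ℕ, y ^ 2 ^ e ∈ Ideal.span
          ((fun z : Localization.AtPrime Q => z ^ 2 ^ e) ''
            (Ideal.span (Set.range s) : Set (Localization.AtPrime Q)))) → y ∈ Ideal.span (Set.range s) := by
  haveI : Fact (Nat.Prime 2) := ⟨Nat.prime_two⟩
  have h23 := two_three k (n := m + 3)
  have hdg : ∀ j : Fin (m + 3), j ≠ i →
      pderiv j (1 + ∑ l ∈ Finset.univ.erase i, (X l : MvPolynomial (Fin (m + 3)) k) ^ 3) = X j ^ 2 := fun j hji => by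
    rw [pderiv_g k i j hji, h23.2, one_mul]
  have hP : (Q.comap (Ideal.Quotient.mk (Ideal.span
      {(1 + ∑ l ∈ Finset.univ.erase i, (X l : MvPolynomial (Fin (m + 3)) k) ^ 3)}))).IsPrime := Ideal.comap_isPrime _ _
  have hex : ∃ j : Fin (m + 3), j ≠ i ∧ (X j : MvPolynomial (Fin (m + 3)) k) ∉
      Q.comap (Ideal.Quotient.mk (Ideal.span {(1 + ∑ l ∈ Finset.univ.erase i, (X l : MvPolynomial (Fin (m + 3)) k) ^ 3)})) := by
    refine Classical.by_contradiction fun hall => ?_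
    simp only [not_exists, not_and, not_not] at hall
    have hsum : (∑ l ∈ Finset.univ.erase i, (X l : MvPolynomial (Fin (m + 3)) k) ^ 3) ∈
        Q.comap (Ideal.Quotient.mk (Ideal.span {(1 + ∑ l ∈ Finset.univ.erase i, (X l : MvPolynomial (Fin (m + 3)) k) ^ 3)})) :=
      Ideal.sum_mem _ fun l hl => by
        rw [pow_succ]
        exact Ideal.mul_mem_left _ _ (hall l (Finset.ne_of_mem_erase hl))
    have hg := self_mem_comap (1 + ∑ l ∈ Finset.univ.erase i, (X l : MvPolynomial (Fin (m + 3)) k) ^ 3) Q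
    have hmem := sub_mem hg hsum
    rw [add_sub_cancel_right] at hmem
    exact hP.ne_top ((Ideal.eq_top_iff_one _).mpr hmem)
  obtain ⟨j, hji, hj⟩ := hex
  exact ClauseOfPderivNotMem.stub_clauseOfPderivNotMem 2 k (m + 3) _ Q j
    (by rw [hdg j hji]; exact fun h => hj (hP.mem_of_pow_mem 2 h))

/-- **The one-point blow-up of the Fermat cubic cone is FULL at EVERY point** (explicit model `affineBlowup (x̄₀, …, x̄_{n−1})`).
[folklore mathematics; OURS as a certificate] -/
theorem affineBlowup_vertex_fullCl (k : Type) [Field k] [CharP k 2] (m : ℕ) (f : MvPolynomial (Fin (m + 3)) k)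
    (hf : f = ∑ l : Fin (m + 3), X l ^ 3) :
    ∀ y : ↥(affineBlowup (Ideal.span (Set.range fun j : Fin (m + 3) => Ideal.Quotient.mk (Ideal.span {f}) (X j)))),
      FullCl 2 ((affineBlowup (Ideal.span (Set.range fun j : Fin (m + 3) =>
        Ideal.Quotient.mk (Ideal.span {f}) (X j)))).presheaf.stalk y) := by
  haveI : Fact (Nat.Prime 2) := ⟨Nat.prime_two⟩
  have hprime := prime_fermat k m f hf
  exact hypersurfacePointBlowup_fullCl 2 k (m + 3) (by omega) f
    (fun i => 1 + ∑ l ∈ Finset.univ.erase i, (X l : MvPolynomial (Fin (m + 3)) k) ^ 3) 3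
    ((Ideal.span_singleton_prime hprime.ne_zero).mpr hprime) (theta k f hf) (f_not_mem_span_X k m f hf)
    (g_not_mem_span_X k m) (fun P _ hP => regular_off_vertex k m f hf P hP) (fun i Q _ _ => chart_clause k m i Q)

/-! ## §2 The vertex -/

/-- `f = Σ xₗ³` has no constant term. [folklore] -/
theorem constantCoeff_f (k : Type) [Field k] {n : ℕ} (f : MvPolynomial (Fin n) k) (hf : f = ∑ l : Fin n, X l ^ 3) :
    constantCoeff f = 0 := by
  rw [hf, map_sum]
  exact Finset.sum_eq_zero fun l _ => by simp [constantCoeff_X]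

/-- `(x̄₀, …, x̄_{n−1})` is the image of `(X₀, …, X_{n−1})`. [folklore] -/
theorem span_range_mk_X_eq_map (k : Type) [Field k] {n : ℕ} (f : MvPolynomial (Fin n) k) :
    Ideal.span (Set.range fun j : Fin n => Ideal.Quotient.mk (Ideal.span {f}) (X j)) =
      (Ideal.span (Set.range (X : Fin n → MvPolynomial (Fin n) k))).map (Ideal.Quotient.mk (Ideal.span {f})) := by
  rw [Ideal.map_span, ← Set.range_comp]
  rfl

/-- `(x̄₀, …, x̄_{n−1})` pulls back to `(X₀, …, X_{n−1})` (which contains `f`). [folklore] -/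
theorem comap_span_range_mk_X (k : Type) [Field k] {n : ℕ} (f : MvPolynomial (Fin n) k) (hf : f = ∑ l : Fin n, X l ^ 3) :
    (Ideal.span (Set.range fun j : Fin n => Ideal.Quotient.mk (Ideal.span {f}) (X j))).comap (Ideal.Quotient.mk (Ideal.span {f})) =
      Ideal.span (Set.range (X : Fin n → MvPolynomial (Fin n) k)) := by
  rw [span_range_mk_X_eq_map, Ideal.comap_map_of_surjective _ Ideal.Quotient.mk_surjective, sup_eq_left]
  intro g hg
  rw [Ideal.mem_comap, Ideal.mem_bot, Ideal.Quotient.eq_zero_iff_mem, Ideal.mem_span_singleton] at hg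
  obtain ⟨c, rfl⟩ := hg
  refine Ideal.mul_mem_right _ _ ?_
  rw [Fedder.span_range_X_eq_ker, RingHom.mem_ker]
  exact constantCoeff_f k f hf

/-- **The vertex ideal `(x̄₀, …, x̄_{n−1})` is maximal.** [folklore] -/
theorem isMaximal_span_range_mk_X (k : Type) [Field k] {n : ℕ} (f : MvPolynomial (Fin n) k) (hf : f = ∑ l : Fin n, X l ^ 3) :
    (Ideal.span (Set.range fun j : Fin n => Ideal.Quotient.mk (Ideal.span {f}) (X j))).IsMaximal := by
  rw [span_range_mk_X_eq_map]
  haveI : (Ideal.span (Set.range (X : Fin n → MvPolynomial (Fin n) k))).IsMaximal :=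
    QuotientOriginMaximal.idealOfVars_isMaximal k (n := n)
  refine Ideal.IsMaximal.map_of_surjective_of_ker_le Ideal.Quotient.mk_surjective ?_
  rw [Ideal.mk_ker, Ideal.span_singleton_le_iff_mem, Fedder.span_range_X_eq_ker, RingHom.mem_ker]
  exact constantCoeff_f k f hf

/-- **The vertex exists**: `(x̄₀, …, x̄_{n−1})` is a point of `X = Spec k[X]/(f)`. [folklore] -/
theorem exists_vertex (k : Type) [Field k] {n : ℕ} (f : MvPolynomial (Fin n) k) (hf : f = ∑ l : Fin n, X l ^ 3) :
    ∃ v : Spec (.of (MvPolynomial (Fin n) k ⧸ Ideal.span {f})),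
      v.asIdeal = Ideal.span (Set.range fun j : Fin n => Ideal.Quotient.mk (Ideal.span {f}) (X j)) :=
  ⟨⟨_, (isMaximal_span_range_mk_X k f hf).isPrime⟩, rfl⟩

/-! ## §3 The five hypotheses of the germ form at the vertex -/

/-- (H1) **The vertex is a closed point.** [folklore] -/
theorem isClosed_vertex (k : Type) [Field k] {n : ℕ} (f : MvPolynomial (Fin n) k) (hf : f = ∑ l : Fin n, X l ^ 3)
    (v : Spec (.of (MvPolynomial (Fin n) k ⧸ Ideal.span {f})))
    (hv : v.asIdeal = Ideal.span (Set.range fun j : Fin n => Ideal.Quotient.mk (Ideal.span {f}) (X j))) :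
    IsClosed ({v} : Set (Spec (.of (MvPolynomial (Fin n) k ⧸ Ideal.span {f})))) := by
  have h : v.asIdeal.IsMaximal := by
    rw [hv]
    exact isMaximal_span_range_mk_X k f hf
  exact (PrimeSpectrum.isClosed_singleton_iff_isMaximal v).mpr h

/-- A point of `Spec R` with a regular local ring lies in the regular locus. [folklore] -/
theorem mem_regularLocus_Spec_of_isRegularLocalRing {R : Type} [CommRing R] (x : Spec (.of R))
    (h : IsRegularLocalRing (Localization.AtPrime x.asIdeal)) : x ∈ Scheme.regularLocus (Spec (.of R)) := by
  letI : Algebra R ((Spec (.of R)).presheaf.stalk x) := (StructureSheaf.toStalk R x).hom.toAlgebra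
  have hloc : IsLocalization.AtPrime ((Spec (.of R)).presheaf.stalk x) x.asIdeal :=
    StructureSheaf.IsLocalization.to_stalk R x
  exact IsRegularLocalRing.of_ringEquiv (IsLocalization.algEquiv x.asIdeal.primeCompl (Localization.AtPrime x.asIdeal)
    ((Spec (.of R)).presheaf.stalk x)).toRingEquiv

/-- (H2) **The vertex is NOT a regular point**: `f ≠ 0`, `f(0) = 0`, `∇f(0) = 0` (`∂f/∂xⱼ = 3xⱼ²`), Jacobian criterion in the singular direction.
[cite: Hartshorne1977, I Thm. 5.1; Matsumura1987, Thm. 14.2] -/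
theorem vertex_not_mem_regularLocus (k : Type) [Field k] [CharP k 2] (m : ℕ) (f : MvPolynomial (Fin (m + 3)) k)
    (hf : f = ∑ l : Fin (m + 3), X l ^ 3)
    (v : Spec (.of (MvPolynomial (Fin (m + 3)) k ⧸ Ideal.span {f})))
    (hv : v.asIdeal = Ideal.span (Set.range fun j : Fin (m + 3) => Ideal.Quotient.mk (Ideal.span {f}) (X j))) :
    v ∉ Scheme.regularLocus (Spec (.of (MvPolynomial (Fin (m + 3)) k ⧸ Ideal.span {f}))) := by
  classical
  refine not_mem_regularLocus_Spec_of_not_isRegularLocalRing v ?_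
  refine not_isRegularLocalRing_localization_of_pderiv_eval_eq_zero (0 : Fin (m + 3) → k) (prime_fermat k m f hf).ne_zero
    ?_ ?_ v.asIdeal ?_
  · rw [MvPolynomial.eval_zero]
    exact constantCoeff_f k f hf
  · intro j
    rw [pderiv_f k f hf j, map_mul, map_pow, MvPolynomial.eval_X, Pi.zero_apply, zero_pow two_ne_zero, mul_zero]
  · rw [hv, comap_span_range_mk_X k f hf, MvPolynomial.eval_zero, Fedder.span_range_X_eq_ker]

/-- (H3) **`dim 𝒪_{X,v} = n − 1`** (hypersurface in `𝔸ⁿ`, closed point). [cite: Matsumura1987, §5 Ex. 5.1 and Thm. 13.5] -/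
theorem ringKrullDim_stalk_vertex (k : Type) [Field k] [CharP k 2] (m : ℕ) (f : MvPolynomial (Fin (m + 3)) k)
    (hf : f = ∑ l : Fin (m + 3), X l ^ 3)
    (v : Spec (.of (MvPolynomial (Fin (m + 3)) k ⧸ Ideal.span {f})))
    (hv : v.asIdeal = Ideal.span (Set.range fun j : Fin (m + 3) => Ideal.Quotient.mk (Ideal.span {f}) (X j))) :
    ringKrullDim ((Spec (.of (MvPolynomial (Fin (m + 3)) k ⧸ Ideal.span {f}))).presheaf.stalk v) = (m + 2 : ℕ) := by
  haveI : v.asIdeal.IsMaximal := by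
    rw [hv]
    exact isMaximal_span_range_mk_X k f hf
  rw [ringKrullDim_stalk_Spec_eq]
  exact HypersurfaceLocalDim.stub_hypersurfaceLocalDim k (m + 2) f (prime_fermat k m f hf).ne_zero v.asIdeal

/-- **`X` is regular at every proper generization of the vertex** (indeed at every point `≠ v`). [cite: Hartshorne1977, I Thm. 5.1] -/
theorem regular_of_ne_vertex (k : Type) [Field k] [CharP k 2] (m : ℕ) (f : MvPolynomial (Fin (m + 3)) k)
    (hf : f = ∑ l : Fin (m + 3), X l ^ 3)
    (v : Spec (.of (MvPolynomial (Fin (m + 3)) k ⧸ Ideal.span {f})))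
    (hv : v.asIdeal = Ideal.span (Set.range fun j : Fin (m + 3) => Ideal.Quotient.mk (Ideal.span {f}) (X j))) :
    ∀ y : Spec (.of (MvPolynomial (Fin (m + 3)) k ⧸ Ideal.span {f})), y ⤳ v → y ≠ v →
      y ∈ Scheme.regularLocus (Spec (.of (MvPolynomial (Fin (m + 3)) k ⧸ Ideal.span {f}))) := by
  intro y hy hne
  refine mem_regularLocus_Spec_of_isRegularLocalRing y (regular_off_vertex k m f hf y.asIdeal fun hle => hne ?_)
  have h2 : y.asIdeal ≤ v.asIdeal := (PrimeSpectrum.le_iff_specializes y v).mpr hy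
  exact PrimeSpectrum.ext (le_antisymm h2 (hv ▸ hle))

/-- (H4) **ISOLATED: `Spec 𝒪_{X,v}` is regular off its closed point.** [cite: Hartshorne1977, I Thm. 5.1; Temkin2008, §2.1] -/
theorem regular_off_closedPoint_vertex (k : Type) [Field k] [CharP k 2] (m : ℕ) (f : MvPolynomial (Fin (m + 3)) k)
    (hf : f = ∑ l : Fin (m + 3), X l ^ 3)
    (v : Spec (.of (MvPolynomial (Fin (m + 3)) k ⧸ Ideal.span {f})))
    (hv : v.asIdeal = Ideal.span (Set.range fun j : Fin (m + 3) => Ideal.Quotient.mk (Ideal.span {f}) (X j))) :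
    ∀ s : Spec ((Spec (.of (MvPolynomial (Fin (m + 3)) k ⧸ Ideal.span {f}))).presheaf.stalk v),
      s ≠ closedPoint _ → s ∈ Scheme.regularLocus (Spec ((Spec (.of (MvPolynomial (Fin (m + 3)) k ⧸ Ideal.span {f}))).presheaf.stalk v)) :=
  regularLocus_Spec_stalk_of_isolated v (regular_of_ne_vertex k m f hf v hv)

/-- **Every local ring of `X` is Cohen–Macaulay** (a hypersurface in a regular local ring `k[X]_P`; `Fedder.sop_isWeaklyRegular_quotient`, transported
along `k[X]_P/(f) ≅ (k[X]/(f))_{P/(f)}`); in particular at the vertex. [cite: Matsumura1987, Thm. 17.4 (iii) and Thm. 17.8] -/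
theorem cmCl_localization (k : Type) [Field k] [CharP k 2] (m : ℕ) (f : MvPolynomial (Fin (m + 3)) k)
    (hf : f = ∑ l : Fin (m + 3), X l ^ 3)
    (v : Spec (.of (MvPolynomial (Fin (m + 3)) k ⧸ Ideal.span {f}))) :
    CMCl (Localization.AtPrime v.asIdeal) := by
  set P : Ideal (MvPolynomial (Fin (m + 3)) k) := v.asIdeal.comap (Ideal.Quotient.mk (Ideal.span {f})) with hPdef
  haveI : IsRegularLocalRing (Localization.AtPrime P) := IsRegularRing.isRegularLocalRing_localization P
  have hf0 : f ≠ 0 := (prime_fermat k m f hf).ne_zero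
  have hfP : f ∈ P := self_mem_comap f v.asIdeal
  have hinj : Function.Injective (algebraMap (MvPolynomial (Fin (m + 3)) k) (Localization.AtPrime P)) :=
    IsLocalization.injective (Localization.AtPrime P) P.primeCompl_le_nonZeroDivisors
  have hfm : algebraMap (MvPolynomial (Fin (m + 3)) k) (Localization.AtPrime P) f ∈ maximalIdeal (Localization.AtPrime P) := by
    rw [← IsLocalization.AtPrime.map_eq_maximalIdeal P (Localization.AtPrime P)]
    exact Ideal.mem_map_of_mem _ hfP
  have hf0' : algebraMap (MvPolynomial (Fin (m + 3)) k) (Localization.AtPrime P) f ≠ 0 := fun h =>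
    hf0 (hinj (by rw [h, map_zero]))
  have hCM : CMCl (Localization.AtPrime P ⧸ Ideal.span {algebraMap (MvPolynomial (Fin (m + 3)) k) (Localization.AtPrime P) f}) :=
    fun d hd s hs => Fedder.sop_isWeaklyRegular_quotient hfm hf0' d hd s hs
  obtain ⟨e⟩ := QuotLocalizationIso.stub_quotLocalizationIso (MvPolynomial (Fin (m + 3)) k) f P v.asIdeal rfl
  exact cmClause_of_ringEquiv e hCM

/-- (H5) **The CM-clause holds at EVERY point of `Spec 𝒪_{X,v}`** (`cmCl_localization` at the closed point, transported; the other points are regular).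
[cite: Matsumura1987, Thm. 17.4 and Thm. 17.8; BrunsHerzog1993, Cor. 2.2.6] -/
theorem cmCl_Spec_stalk_vertex (k : Type) [Field k] [CharP k 2] (m : ℕ) (f : MvPolynomial (Fin (m + 3)) k)
    (hf : f = ∑ l : Fin (m + 3), X l ^ 3)
    (v : Spec (.of (MvPolynomial (Fin (m + 3)) k ⧸ Ideal.span {f})))
    (hv : v.asIdeal = Ideal.span (Set.range fun j : Fin (m + 3) => Ideal.Quotient.mk (Ideal.span {f}) (X j))) :
    ∀ s : Spec ((Spec (.of (MvPolynomial (Fin (m + 3)) k ⧸ Ideal.span {f}))).presheaf.stalk v),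
      CMCl ((Spec ((Spec (.of (MvPolynomial (Fin (m + 3)) k ⧸ Ideal.span {f}))).presheaf.stalk v)).presheaf.stalk s) :=
  cmCl_Spec_stalk_of_isolated v (cmCl_stalk_Spec_of_cmCl_localization v (cmCl_localization k m f hf v))
    (regular_of_ne_vertex k m f hf v hv)

/-! ## §4 The conclusion at the vertex, and the scheme-level side conditions -/

/-- ★ **`GermForm.FInjectivizationGermAt 2 v` AT THE VERTEX OF THE FERMAT CUBIC CONE** (characteristic 2, `n ≥ 3` variables): the blow-up of the
closed point of `Spec 𝒪_{X,v}` is FULL at every point. Certificate: the one-point blow-up of `X` (`affineBlowup_vertex_fullCl`) through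
`GermOfGlobalBlowup.fInjectivizationGermAt_origin_of_hypersurfacePointBlowup`. TRIVIAL STRATUM (FULL via a regular model).
[folklore mathematics; OURS as a certificate] -/
theorem fInjectivizationGermAt_vertex (k : Type) [Field k] [CharP k 2] (m : ℕ) (f : MvPolynomial (Fin (m + 3)) k)
    (hf : f = ∑ l : Fin (m + 3), X l ^ 3)
    (v : Spec (.of (MvPolynomial (Fin (m + 3)) k ⧸ Ideal.span {f})))
    (hv : v.asIdeal = Ideal.span (Set.range fun j : Fin (m + 3) => Ideal.Quotient.mk (Ideal.span {f}) (X j))) :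
    FInjectivizationGermAt 2 v := by
  haveI : Fact (Nat.Prime 2) := ⟨Nat.prime_two⟩
  have hprime := prime_fermat k m f hf
  exact fInjectivizationGermAt_origin_of_hypersurfacePointBlowup 2 k (m + 3) (by omega) f
    (fun i => 1 + ∑ l ∈ Finset.univ.erase i, (X l : MvPolynomial (Fin (m + 3)) k) ^ 3) 3
    ((Ideal.span_singleton_prime hprime.ne_zero).mpr hprime) (theta k f hf) (f_not_mem_span_X k m f hf)
    (g_not_mem_span_X k m) (fun P _ hP => regular_off_vertex k m f hf P hP) (fun i Q _ _ => chart_clause k m i Q) v hv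

/-- `X = Spec k[X]/(f)` is an integral scheme. [folklore] -/
theorem isIntegral_cone (k : Type) [Field k] [CharP k 2] (m : ℕ) (f : MvPolynomial (Fin (m + 3)) k)
    (hf : f = ∑ l : Fin (m + 3), X l ^ 3) :
    IsIntegral (Spec (.of (MvPolynomial (Fin (m + 3)) k ⧸ Ideal.span {f}))) := by
  haveI := (Ideal.span_singleton_prime (prime_fermat k m f hf).ne_zero).mpr (prime_fermat k m f hf)
  haveI : IsDomain (MvPolynomial (Fin (m + 3)) k ⧸ Ideal.span {f}) := Ideal.Quotient.isDomain _
  infer_instance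

/-- The structure morphism `X → Spec k` is separated (affine). [folklore] -/
theorem structureMorphism_isSeparated (k : Type) [Field k] {n : ℕ} (f : MvPolynomial (Fin n) k) :
    IsSeparated (Spec.map (CommRingCat.ofHom (algebraMap k (MvPolynomial (Fin n) k ⧸ Ideal.span {f})))) :=
  inferInstance

/-- The structure morphism `X → Spec k` is quasi-compact (affine). [folklore] -/
theorem structureMorphism_quasiCompact (k : Type) [Field k] {n : ℕ} (f : MvPolynomial (Fin n) k) :
    QuasiCompact (Spec.map (CommRingCat.ofHom (algebraMap k (MvPolynomial (Fin n) k ⧸ Ideal.span {f})))) :=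
  inferInstance

/-- The structure morphism `X → Spec k` is locally of finite type (`k[X]/(f)` is a finitely generated `k`-algebra). [folklore] -/
theorem structureMorphism_locallyOfFiniteType (k : Type) [Field k] {n : ℕ} (f : MvPolynomial (Fin n) k) :
    LocallyOfFiniteType (Spec.map (CommRingCat.ofHom (algebraMap k (MvPolynomial (Fin n) k ⧸ Ideal.span {f})))) := by
  rw [HasRingHomProperty.Spec_iff (P := @LocallyOfFiniteType)]
  have h : Algebra.FiniteType k (MvPolynomial (Fin n) k ⧸ Ideal.span {f}) :=
    Algebra.FiniteType.of_surjective (Ideal.Quotient.mkₐ k (Ideal.span {f})) (Ideal.Quotient.mkₐ_surjective k _)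
  exact RingHom.finiteType_algebraMap.mpr h

/-! ## §5 The instance, assembled -/

/-- ★★ **THE VERTEX OF THE FERMAT CUBIC CONE IS A POSITIVE INSTANCE OF THE F-HALF'S GERM FORM, IN EVERY DIMENSION.** For every field `k` of
characteristic `2`, every `n ≥ 3`, `X = Spec k[x₀,…,x_{n−1}]/(Σ xₗ³)` and its vertex `v`: ALL FIVE point-hypotheses of
`GermForm.LocalFInjectivizationGerm 2 (n − 1)` hold at `(X, v)` — `v` closed, `v ∉ Reg X`, `dim 𝒪_{X,v} = n − 1`, `Spec 𝒪_{X,v}` regular off its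
closed point, CM-clause at every point of `Spec 𝒪_{X,v}` — AND its conclusion `FInjectivizationGermAt 2 v` holds (the scheme-level binders:
`isIntegral_cone`, `structureMorphism_isSeparated`, `…_locallyOfFiniteType`, `…_quasiCompact`). Hence, for `n ≥ 5`, a kernel-certified positive
instance of the registered F-half `LocalFInjectivizationFibreAdmGe4` at `I = ⊤`, level `d = n − 1 ≥ 4`, in exact currency
(`GermForm.localFInjectivizationFibreAdmGe4_at_top_iff_germ`). CENSUS LABEL: TRIVIAL STRATUM «FULL via a REGULAR model» (res-L1-w45a-tri-2 #348 (c)).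
[folklore mathematics; OURS as a certificate] -/
theorem fermatCubicCone_vertex_germ_instance (n : ℕ) (hn : 3 ≤ n) (k : Type) [Field k] [CharP k 2]
    (f : MvPolynomial (Fin n) k) (hf : f = ∑ l : Fin n, X l ^ 3)
    (v : Spec (.of (MvPolynomial (Fin n) k ⧸ Ideal.span {f})))
    (hv : v.asIdeal = Ideal.span (Set.range fun j : Fin n => Ideal.Quotient.mk (Ideal.span {f}) (X j))) :
    IsClosed ({v} : Set (Spec (.of (MvPolynomial (Fin n) k ⧸ Ideal.span {f})))) ∧
    v ∉ Scheme.regularLocus (Spec (.of (MvPolynomial (Fin n) k ⧸ Ideal.span {f}))) ∧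
    ringKrullDim ((Spec (.of (MvPolynomial (Fin n) k ⧸ Ideal.span {f}))).presheaf.stalk v) = (n - 1 : ℕ) ∧
    (∀ s : Spec ((Spec (.of (MvPolynomial (Fin n) k ⧸ Ideal.span {f}))).presheaf.stalk v), s ≠ closedPoint _ →
      s ∈ Scheme.regularLocus (Spec ((Spec (.of (MvPolynomial (Fin n) k ⧸ Ideal.span {f}))).presheaf.stalk v))) ∧
    (∀ s : Spec ((Spec (.of (MvPolynomial (Fin n) k ⧸ Ideal.span {f}))).presheaf.stalk v),
      CMCl ((Spec ((Spec (.of (MvPolynomial (Fin n) k ⧸ Ideal.span {f}))).presheaf.stalk v)).presheaf.stalk s)) ∧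
    FInjectivizationGermAt 2 v := by
  obtain ⟨m, rfl⟩ : ∃ m, n = m + 3 := ⟨n - 3, by omega⟩
  exact ⟨isClosed_vertex k f hf v hv, vertex_not_mem_regularLocus k m f hf v hv,
    by rw [ringKrullDim_stalk_vertex k m f hf v hv, show m + 3 - 1 = m + 2 by omega], regular_off_closedPoint_vertex k m f hf v hv,
    cmCl_Spec_stalk_vertex k m f hf v hv, fInjectivizationGermAt_vertex k m f hf v hv⟩

end Summit.ResolutionOfSingularities.ResolutionOfSingularities.Theorems.FInjectiveMacaulayfication.FermatCubicConeGerm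

end
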